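import Summits.HodgeConjecture.HodgeConjecture.Theorems.Ring2WeilCoverageCMFieldCellsSign
import Summits.HodgeConjecture.HodgeConjecture.Theorems.Ring2WeilCoverageCMFieldNormWitnesses
import HarnessLib

/-!
# Ring 2 — Weil-type family-coverage census, CM-field rows (X-W): the rows of ODD `E`-rank half `k` — `[−1] ≠ [1]`
# on every Deligne carrier, the split class `[(−1)^k]` alternates with `k`, and the `g = 12` rows `(2,3)` are the
# `g = 8` tables `(2,2)` read with `δ ↦ −δ`

HONEST FRAMING: research route conditional on HC_CM; not a corollary; Q11.4-sentence-2 already refuted in dim ≥ 3.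

Cell `pub-hodge-ring2`, seat `ring2-b03` (gen 58), census `WEIL-FAMILY-COVERAGE.md` «## b03» b03.8 / open cell (iv′), the
OTHER kind of `g = 12` row: `(e₀, k) = (2, 3)` — `E` a QUARTIC CM field, `E`-rank `2k = 6`, `A` a twelvefold of Weil
signature `(3,3;3,3)`, `W_E ⊂ H⁶(A, ℚ)` of codimension `3`; by Deligne's (1) the discriminant of a polarized member is
TOTALLY NEGATIVE (`sign_τ δ = (−1)^{b_τ} = (−1)³`; parts X-D/X-I: `re_neg_of_kaehler_member_three`), and the SPLIT
class is `[(−1)³] = [−1]` (Cor. 4.2 (a)). On the carriers `F = realField R`, `E = cmField R`,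
`cmNormResidueGroup R = F^×/Nm_{E/F}(E^×)`, `splitDiscriminantClassCM R k = [(−1)^k]`:

* **`mk_neg_one_ne_one`** — `[−1] ≠ [1]`: `−1` is not a norm from `E` to `F` (a norm `z z̄` is positive at every real
  place — part X-D `sign_re_ringHom_of_mk_eq_mk` — while `−1` is negative); needs only the roots of `R` real negative.
* `splitDiscriminantClassCM_succ` (`[(−1)^{k+1}] = [−1]·[(−1)^k]`), `splitDiscriminantClassCM_add_two` (period `2`),
  `splitDiscriminantClassCM_three` (`= [−1]`), **`splitDiscriminantClassCM_succ_ne`** (`[(−1)^{k+1}] ≠ [(−1)^k]`: the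
  split classes of consecutive ranks are DIFFERENT rows), `splitDiscriminantClassCM_three_ne_one`.
* **`mk_neg_eq_splitDiscriminantClassCM_succ_iff`** — `[−q] = [(−1)^{k+1}] ⟺ [q] = [(−1)^k]`: multiplication by
  `[−1]` is a bijection of `F^×/Nm(E^×)` carrying the split class of rank `k` to that of rank `k + 1` (and, `−1` being
  totally negative, the totally positive classes onto the totally negative ones); `mk_neg_eq_split_three_iff`,
  `mk_eq_split_three_iff_neg`, `mk_neg_ne_split_three_iff`: **the `(2,3)` rows `W12.E.[−δ]` are the `(2,2)` rows
  `W8.E.[δ]` of the census tables b03.5–b03.22, split ↔ split and non-split ↔ non-split** — every kernel decision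
  `[n] = [1]` / `[n] ≠ [1]` of parts I–W and X-P…X-T transfers verbatim to `[−n]` against `[(−1)³]`.

THEOREMS ONLY: no `def`, no named fact, no `sorry`; `HC_CM` does not occur; nothing about the Hodge conjecture is
asserted (index-level bookkeeping of the rows; the CM member with HC on every `(2,3)` row is parts X-C/X-L with `p = 3`;
the general member of every row is OPEN — crux stmt-1076).

## References
* [Deligne1982HodgeCycles] P. Deligne (notes by J. S. Milne), LNM 900 (1982), §4 p. 30 (1) (`sign(τ f) = (−1)^{b_τ}`),
  Cor. 4.2 (a) (`disc = (−1)^{d/2}`).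
* [vanGeemen1994HodgeAV] B. van Geemen, LNM 1594 (1994), 4.14 (the quadratic case `ℚ^×/Nm K^×`).
-/

noncomputable section

set_option linter.dupNamespace false

namespace Summit.HodgeConjecture.HodgeConjecture.Ring2.WeilCoverageCM

open Polynomial
open Literature.AlgebraicGeometry.Deligne1982
open Literature.AlgebraicGeometry.HodgeTheory (splitDiscriminantClassCM)

variable {R : Polynomial ℤ} [Fact (Irreducible (realPolyQ R))]

/-- **`[−1] ≠ [1]` in `F^×/Nm_{E/F}(E^×)`: `−1` is not a norm from the CM field `E` to its real subfield `F`**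
(a norm `z z̄` is positive at every real place of `F`, `−1` is negative; part X-D's sign invariant of a class).
[cite: Deligne1982HodgeCycles, §4 p. 30 (1)] -/
theorem mk_neg_one_ne_one [Fact (Irreducible (cmPolyQ R))]
    (hR : ∀ s : ℂ, Polynomial.eval₂ (Int.castRingHom ℂ) s R = 0 → s.im = 0 ∧ s.re < 0) :
    (QuotientGroup.mk (-1 : (realField R)ˣ) : cmNormResidueGroup R) ≠ 1 := by
  intro h
  obtain ⟨τ⟩ : Nonempty (cmField R →+* ℂ) := inferInstance
  have h' : (QuotientGroup.mk (1 : (realField R)ˣ) : cmNormResidueGroup R) = QuotientGroup.mk (-1) := by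
    rw [h, QuotientGroup.mk_one]
  have hs := sign_re_ringHom_of_mk_eq_mk hR h' τ
  rw [Units.val_neg, Units.val_one, map_neg, map_one, map_neg, map_one, Complex.neg_re, Complex.one_re] at hs
  linarith

/-- `[(−1)^{k+1}] = [−1] · [(−1)^k]`. [cite: Deligne1982HodgeCycles, §4 Cor. 4.2 (a)] -/
theorem splitDiscriminantClassCM_succ (k : ℕ) :
    splitDiscriminantClassCM R (k + 1) =
      (QuotientGroup.mk (-1 : (realField R)ˣ) : cmNormResidueGroup R) * splitDiscriminantClassCM R k := by
  rw [splitDiscriminantClassCM, splitDiscriminantClassCM, pow_succ', QuotientGroup.mk_mul]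

/-- `[(−1)^{k+2}] = [(−1)^k]`: the split class only depends on the parity of `k`. [cite: Deligne1982HodgeCycles, §4 Cor. 4.2 (a)] -/
theorem splitDiscriminantClassCM_add_two (k : ℕ) :
    splitDiscriminantClassCM R (k + 2) = splitDiscriminantClassCM R k := by
  rw [splitDiscriminantClassCM, splitDiscriminantClassCM, pow_add, neg_one_sq, mul_one]

/-- **The split class of rank `3` is `[−1]`** (`(2,3)` rows: `disc = (−1)³`). [cite: Deligne1982HodgeCycles, §4 Cor. 4.2 (a)] -/
theorem splitDiscriminantClassCM_three :
    splitDiscriminantClassCM R 3 = (QuotientGroup.mk (-1 : (realField R)ˣ) : cmNormResidueGroup R) := by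
  rw [splitDiscriminantClassCM_succ, splitDiscriminantClassCM_two_eq_one]
  exact mul_one ((QuotientGroup.mk (-1 : (realField R)ˣ) : cmNormResidueGroup R))

/-- **Consecutive ranks have DIFFERENT split rows**: `[(−1)^{k+1}] ≠ [(−1)^k]`. [cite: Deligne1982HodgeCycles, §4 Cor. 4.2 (a)] -/
theorem splitDiscriminantClassCM_succ_ne [Fact (Irreducible (cmPolyQ R))]
    (hR : ∀ s : ℂ, Polynomial.eval₂ (Int.castRingHom ℂ) s R = 0 → s.im = 0 ∧ s.re < 0) (k : ℕ) :
    splitDiscriminantClassCM R (k + 1) ≠ splitDiscriminantClassCM R k := by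
  rw [splitDiscriminantClassCM_succ]
  intro h
  refine mk_neg_one_ne_one hR ?_
  calc (QuotientGroup.mk (-1 : (realField R)ˣ) : cmNormResidueGroup R)
        = QuotientGroup.mk (-1 : (realField R)ˣ) * splitDiscriminantClassCM R k * (splitDiscriminantClassCM R k)⁻¹ :=
          (mul_inv_cancel_right _ _).symm
    _ = splitDiscriminantClassCM R k * (splitDiscriminantClassCM R k)⁻¹ := by rw [h]
    _ = 1 := mul_inv_cancel _

/-- **The split row of rank `3` is not the row `[1]`** (the split row of rank `2`). [cite: Deligne1982HodgeCycles, §4 Cor. 4.2 (a)] -/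
theorem splitDiscriminantClassCM_three_ne_one [Fact (Irreducible (cmPolyQ R))]
    (hR : ∀ s : ℂ, Polynomial.eval₂ (Int.castRingHom ℂ) s R = 0 → s.im = 0 ∧ s.re < 0) :
    splitDiscriminantClassCM R 3 ≠ 1 := by
  rw [splitDiscriminantClassCM_three]
  exact mk_neg_one_ne_one hR

/-- **The shift `δ ↦ −δ` between consecutive ranks**: `[−q] = [(−1)^{k+1}] ⟺ [q] = [(−1)^k]`.
[cite: Deligne1982HodgeCycles, §4 Cor. 4.2 (a)] -/
theorem mk_neg_eq_splitDiscriminantClassCM_succ_iff (q : (realField R)ˣ) (k : ℕ) :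
    (QuotientGroup.mk (-q) : cmNormResidueGroup R) = splitDiscriminantClassCM R (k + 1) ↔
      (QuotientGroup.mk q : cmNormResidueGroup R) = splitDiscriminantClassCM R k := by
  rw [splitDiscriminantClassCM_succ, ← neg_one_mul q, QuotientGroup.mk_mul]
  constructor
  · intro h
    calc (QuotientGroup.mk q : cmNormResidueGroup R)
          = (QuotientGroup.mk (-1 : (realField R)ˣ) : cmNormResidueGroup R)⁻¹ *
              ((QuotientGroup.mk (-1 : (realField R)ˣ) : cmNormResidueGroup R) * QuotientGroup.mk q) :=
            (inv_mul_cancel_left _ _).symm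
      _ = (QuotientGroup.mk (-1 : (realField R)ˣ) : cmNormResidueGroup R)⁻¹ *
              ((QuotientGroup.mk (-1 : (realField R)ˣ) : cmNormResidueGroup R) * splitDiscriminantClassCM R k) := by
            rw [h]
      _ = splitDiscriminantClassCM R k := inv_mul_cancel_left _ _
  · intro h
    rw [h]

/-- **The `(2,3)` rows are the `(2,2)` tables negated, split side**: `[−q] = [(−1)³] ⟺ [q] = [(−1)²]` (`= [1]`).
[cite: Deligne1982HodgeCycles, §4 Cor. 4.2 (a)] -/
theorem mk_neg_eq_split_three_iff (q : (realField R)ˣ) :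
    (QuotientGroup.mk (-q) : cmNormResidueGroup R) = splitDiscriminantClassCM R 3 ↔
      (QuotientGroup.mk q : cmNormResidueGroup R) = splitDiscriminantClassCM R 2 :=
  mk_neg_eq_splitDiscriminantClassCM_succ_iff q 2

/-- … read the other way: `[q] = [(−1)³] ⟺ [−q] = [(−1)²]`. [cite: Deligne1982HodgeCycles, §4 Cor. 4.2 (a)] -/
theorem mk_eq_split_three_iff_neg (q : (realField R)ˣ) :
    (QuotientGroup.mk q : cmNormResidueGroup R) = splitDiscriminantClassCM R 3 ↔
      (QuotientGroup.mk (-q) : cmNormResidueGroup R) = splitDiscriminantClassCM R 2 := by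
  have h := mk_neg_eq_splitDiscriminantClassCM_succ_iff (R := R) (-q) 2
  rwa [neg_neg] at h

/-- **… and non-split side**: `[−q] ≠ [(−1)³] ⟺ [q] ≠ [(−1)²]` — every NON-SPLIT decision `[n] ≠ [1]` of the `g = 8`
tables is the non-split decision `[−n] ≠ [(−1)³]` of the `(2,3)` rows, and conversely. [cite: Deligne1982HodgeCycles, §4 Cor. 4.2 (a)] -/
theorem mk_neg_ne_split_three_iff (q : (realField R)ˣ) :
    (QuotientGroup.mk (-q) : cmNormResidueGroup R) ≠ splitDiscriminantClassCM R 3 ↔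
      (QuotientGroup.mk q : cmNormResidueGroup R) ≠ splitDiscriminantClassCM R 2 :=
  (mk_neg_eq_split_three_iff q).not

/-- **`[1]` is NOT the split row at rank `3`** — e.g. the plain product polarization class `[1]` of
`B³ × (B^ρ)³` (census b03.9 (ii′): constant `c = (−1)^k`… here read through the shift) lies on a NON-split `(2,3)` row —
while `[−1]` is: `[−1] = [(−1)³]`. [cite: Deligne1982HodgeCycles, §4 Cor. 4.2 (a)] -/
theorem mk_one_ne_split_three [Fact (Irreducible (cmPolyQ R))]
    (hR : ∀ s : ℂ, Polynomial.eval₂ (Int.castRingHom ℂ) s R = 0 → s.im = 0 ∧ s.re < 0) :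
    (QuotientGroup.mk (1 : (realField R)ˣ) : cmNormResidueGroup R) ≠ splitDiscriminantClassCM R 3 := by
  rw [QuotientGroup.mk_one, splitDiscriminantClassCM_three]
  exact (mk_neg_one_ne_one hR).symm

end Summit.HodgeConjecture.HodgeConjecture.Ring2.WeilCoverageCM

end
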